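import Summits.QuantumFields.YangMills.Theorems.UnitScaleTiltProp7NestedMeanTowerInduction
import Summits.QuantumFields.YangMills.Theorems.UnitScaleTiltProp7NestedMeanPoincareComb
import Summits.QuantumFields.YangMills.Theorems.UnitScaleTiltProp7QTwSCentralTowerRows
import Summits.QuantumFields.YangMills.Theorems.UnitScaleTiltProp7FrameLevelOnto
import Summits.QuantumFields.YangMills.Theorems.UnitScaleTiltProp7SectET3GaugeProjectorT3
import Literature.MathematicalPhysics.QuantumFieldTheory.Balaban1983to89.B5Eq117TorusCarriers
import HarnessLib

/-!
# Route `UnitScaleTilt`, crux K1 child «MinimiserStabilityRegPr» (stmt-QuantumFields-19200), skeleton v10, stub `stub_existenceMinimalOrbit` (EX), route (α) —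
# **ROW-B OF THE (P2-core) PLAN v2: THE BRIDGE `hsucc → mean form`, THE `iterBlock ↔ fibreSite` RE-INDEXING, AND THE SOCKET «`ns_{K−n} l = 0` ⟹
# `‖toL2S l‖² ≤ 2·‖D^η_{U₀}(toL2S l)‖²`» WITH THE TOWER-CLOSENESS DATA DISPLAYED** (★w5-20520 g7 19:25:56Z∕19:27:10Z «ROW-B»; the three (Q1) files of this lineage
# ✓p656268 R2a ∕ ✓p656969 comb socket ∕ ✓p657637 R2a′-alg are composed here; ROW-T — the data `C, g, η, η′` from `RegPr` — is ★ym3-torus-px11 g2's and plugs by `exact`).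

Cell `ym3-torus`, width seat `ym3-torus-px20` (gen 2).  THEOREMS ONLY (0 `def`, 0 `sorry`).  `--supports stmt-QuantumFields-19200 --as helper`, count-neutral.  YM₃ on T³ is a ladder
rung (R3), not the Clay problem; nothing here claims the stub, the crux, d = 4 or the mass gap.

WHAT IS PROVED (sorry-free, no definition; ns `…Theorems.Prop7NestedMeanPoincare`):
* §1 `hstep_of_hsucc` — the averaging-sequence recursion of ✓`Prop7SymAvgTwSGaugeDir.QTwS_gaugeDir_of_avgSeq` (`meanCLM` form: `ns_{j+1}(y) = ns_j(ŷ) − |I|⁻¹Σ_i (ns_j(ŷ) −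
  Ad_{T_{j,y,i}} ns_j(x_{y,i}))`, `x_{y,i} = transl ŷ (disp Γ_i)`) IS the MEAN form of ✓`norm_ns_sub_refMean_le` (`ns_{j+1}(y) = |I|⁻¹•Σ_i Ad_{T_{j,y,i}} ns_j(blockSite y i.1)`):
  `a − |I|⁻¹Σ_i(a − b_i) = |I|⁻¹Σ_i b_i` and ✓`transl_emb_disp_stairWord_eq_blockSite`.
* §2 ★★`norm_ns_sub_refMean_le_of_lt` — the GUARDED edition of ✓`norm_ns_sub_refMean_le`: unitarity of the transports, the recursion and the closeness are assumed only BELOW the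
  target level `k₀ ≤ m + K` (the T³ background tower `Ū₀♭⁽ʲ⁾` is `U1`-valued for `j ≤ K − n` only, ✓`emlIterU_bgUnits_mem_U1_of_regPr`); same induction.
* §3 ★★`norm_combSum_le_of_ns_eq_zero` — for ANY unitary references `C` with the displayed per-level closeness `η_j` and ANY top-level comb family `W y r` with `‖C_{k₀,y,x_r} −
  g_y·W_{y,r}‖ ≤ η′` (`g_y` unitary): `ns_{k₀} = 0 ⟹ ‖Σ_r Ad_{W_{y,r}} l(x_{y,r})‖ ≤ (2Σ_{j<k₀}η_j + 2η′)·Σ_r‖l(x_{y,r})‖` on every top block (`x_{y,r} = fibreSite 0 k₀ y r`;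
  ✓`B5Eq117TorusCarriers.sum_iterBlock_eq` re-indexes `iterBlock k₀ y`).
* §4 ★★★`normSq_toL2S_le_two_mul_of_ns_eq_zero` — AT THE T³ MEMBER, `U₀ ∈ 𝔘_k(ε₀)` (`RegPr`, `10⁷L³ε₀ ≤ 1`): for the averaging sequence `ns` of `l` against the background tower
  (the `h0`∕`hsucc` of ✓`QTwS_gaugeDir_of_avgSeq` VERBATIM) with `ns (K − n) = 0`, and DISPLAYED closeness data (`C`, `η`; `g`, `η′` against the fine corner combs
  `U₀♭(Γ_{ȳ,x_r})` of ✓`normSq_toL2S_le_two_mul_of_combMean_small`) in the window `108ε₀² + 4(2Ση_j + 2η′)² ≤ 1`: **`‖toL2S F K c₀ l‖² ≤ 2·‖DL2 F n K c₀ U₀ (toL2S F K c₀ l)‖²`**.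
* §5 ★★★`hPoinc_of_towerCloseness` — §4 IN THE CURRENCY OF THE R2b″ ROWS ASSEMBLER (★w5-20520 g7 19:37:20Z `hP_of_poincareZ`∕`hS_of_rowsZ`): with the same displayed rows,
  `∀ l₁, toL2S l₁ ∈ N_S(U₀) → Z l₁ → ‖toL2S l₁‖² ≤ 2·‖DL2 U₀ (toL2S l₁)‖²` (`P₂ = 2`), the sector `Z l₁ :=` «some averaging sequence of `l₁` (the `hsucc` recursion) vanishes at level
  `K − n`» spelled inline (def-free); the `N_S` membership is not used.
INHABITABILITY of the displayed rows (№9 (3)): at `U₀ = 1` take `C ≡ 1`, `g ≡ 1`, `η ≡ 0`, `η′ = 0` (all transports are `1`); in general ROW-T supplies them from `RegPr` with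
`Σ_{j<K−n}η_j + η′ = O(L²ε₀)` (block-axial frame or refined-word transport comparison).
HONEST SCOPE.  Finite-sum bookkeeping and composition of landed rows; no estimate of print is asserted; the (H-Z) sector decision (`N_S` vs `ker ns_{K−n}`) is the planner's and
not touched; no stub ∕ crux statement is advanced.

References: T. Bałaban, CMP 98 (1985) 17–51 [Balaban1985Averaging] ((11) p.19, (82) p.30, (97) p.32); CMP 99 (1985) 389–434 [Balaban1985BackgroundPropagators] ((3.19) p.393,
(3.21) p.394, Thm 3.11 p.416); CMP 95 (1984) 17–40 [Balaban1984PropagatorsI] ((1.18) p.20); CMP 102 (1985) 277–309 [Balaban1985Variational] ((2) p.278).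
-/

set_option autoImplicit false

noncomputable section

open scoped BigOperators Matrix.Norms.L2Operator

namespace Summit.QuantumFields.YangMills.Theorems.Prop7NestedMeanPoincare

open Literature.MathematicalPhysics.QuantumFieldTheory.Balaban1983to89
open Finset
open T4Continuum BlockAveraging
open BlockAveraging (Idx)
open B7Prop1Explicit (U1 mem_U1 treeWord disp)
open B7Eq78Linearization (conjR conjR_apply conjR_sub conjR_smul_real)
open B8Ineq132 (norm_conjR conjR_conjR one_conjR conjR_sum)
open B5Eq118OneStroke (iterBlockOf iterBlock mem_iterBlock iterBlock_zero sum_iterBlock_succ)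
open B10StarCount (sum_block)
open B10Eq27TorusAxialLog (holT transl unitsField toUField)
open B7TransferAnalyticMean (meanCLM meanCLM_apply)
open Summit.QuantumFields.YangMills.Theorems.Prop7CovariantCoercivity (norm_conjR_sub_conjR_le)
open Summit.QuantumFields.YangMills.Theorems.Prop8Chart (emlIterU)

variable {N : ℕ} [NeZero N]

/-! ## §1 The bridge: the `meanCLM` recursion is the mean-form recursion -/

section Bridge

variable {P : Params}

omit [NeZero N] in
/-- **THE BRIDGE `hsucc → hstep`**: `ns_j(ŷ) − |I|⁻¹Σ_i (ns_j(ŷ) − T·ns_j(transl ŷ (disp Γ_i))·T⁻¹) = |I|⁻¹•Σ_i Ad_T ns_j(blockSite y i.1)` — the averaging-sequence recursion of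
✓`QTwS_gaugeDir_of_avgSeq` in the mean form consumed by ✓`norm_ns_sub_refMean_le` (`a − |I|⁻¹Σ_i(a − b_i) = |I|⁻¹Σ_i b_i`, the stair end-point is the block site of its offset).
[cite: Balaban1985Averaging, (97) p.32; Balaban1985BackgroundPropagators, (3.19) p.393] -/
theorem hstep_of_hsucc (T : (j : ℕ) → Site P (j + 1) → Idx P → (Matrix (Fin N) (Fin N) ℂ)ˣ)
    (ns : (j : ℕ) → Site P j → Matrix (Fin N) (Fin N) ℂ)
    (hsucc : ∀ (j : ℕ) (y : Site P (j + 1)), ns (j + 1) y = ns j (emb y) - meanCLM (Idx P) (Matrix (Fin N) (Fin N) ℂ) fun i : Idx P =>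
        ns j (emb y) - ((T j y i : (Matrix (Fin N) (Fin N) ℂ)ˣ) : Matrix (Fin N) (Fin N) ℂ) * ns j (transl (emb y) (disp (stairWord i.2.1 (off i.1)))) *
          (((T j y i)⁻¹ : (Matrix (Fin N) (Fin N) ℂ)ˣ) : Matrix (Fin N) (Fin N) ℂ))
    (j : ℕ) (y : Site P (j + 1)) :
    ns (j + 1) y = ((Fintype.card (Idx P) : ℝ)⁻¹) • ∑ i : Idx P, conjR (T j y i) (ns j (Site.blockSite y i.1)) := by
  have hcpos : 0 < Fintype.card (Idx P) := Fintype.card_pos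
  have hc : (Fintype.card (Idx P) : ℂ) ≠ 0 := Nat.cast_ne_zero.mpr hcpos.ne'
  have hfun : (fun i : Idx P => ns j (emb y) - ((T j y i : (Matrix (Fin N) (Fin N) ℂ)ˣ) : Matrix (Fin N) (Fin N) ℂ) * ns j (transl (emb y) (disp (stairWord i.2.1 (off i.1)))) *
          (((T j y i)⁻¹ : (Matrix (Fin N) (Fin N) ℂ)ˣ) : Matrix (Fin N) (Fin N) ℂ))
      = fun i : Idx P => ns j (emb y) - conjR (T j y i) (ns j (Site.blockSite y i.1)) := by
    funext i
    rw [conjR_apply, Prop7FrameLevelOnto.transl_emb_disp_stairWord_eq_blockSite]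
  have hB : ns j (emb y) - meanCLM (Idx P) (Matrix (Fin N) (Fin N) ℂ) (fun i : Idx P => ns j (emb y) - conjR (T j y i) (ns j (Site.blockSite y i.1)))
      = ((Fintype.card (Idx P) : ℂ)⁻¹) • ∑ i : Idx P, conjR (T j y i) (ns j (Site.blockSite y i.1)) := by
    simp only [meanCLM_apply, Finset.sum_sub_distrib, Finset.sum_const, Finset.card_univ, smul_sub, ← Nat.cast_smul_eq_nsmul ℂ, smul_smul,
      inv_mul_cancel₀ hc, one_smul, sub_sub_cancel]
  have hRC : ((Fintype.card (Idx P) : ℝ)⁻¹) • ∑ i : Idx P, conjR (T j y i) (ns j (Site.blockSite y i.1))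
      = ((Fintype.card (Idx P) : ℂ)⁻¹) • ∑ i : Idx P, conjR (T j y i) (ns j (Site.blockSite y i.1)) := by
    rw [RCLike.real_smul_eq_coe_smul (K := ℂ)]
    push_cast
    rfl
  rw [hsucc j y, hfun, hB, hRC]

end Bridge

/-! ## §2 The tower induction with hypotheses only below the target level -/

section Guarded

variable {P : Params}

set_option maxHeartbeats 400000 in
/-- ★★ **THE NESTED COVARIANT MEAN AGAINST A REFERENCE COMB-TYPE MEAN — GUARDED EDITION** of ✓`norm_ns_sub_refMean_le`: the transports `T_{j,y,i}` are assumed unitary, the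
recursion `ns_{j+1}(y) = |I|⁻¹•Σ_i Ad_{T_{j,y,i}} ns_j(blockSite y i.1)` and the closeness `‖T_{j,y,i}·C_{j,blockSite y i.1,x} − C_{j+1,y,x}‖ ≤ η_j` are assumed only for the
levels `j < k₀` (`k₀ ≤ m + K`), the references `C_j` unitary for `j ≤ k₀`; then for every `k ≤ k₀` and `y ∈ T^{(k)}`:
`‖ns_k(y) − (L^d)^{−k}·Σ_{x∈B^k(y)} Ad_{C_{k,y,x}} l(x)‖ ≤ (2Σ_{j<k}η_j)·(L^d)^{−k}·Σ_{x∈B^k(y)}‖l(x)‖`.  Same induction (nesting ✓`sum_iterBlock_succ`∕✓`sum_block`, the `Idx` mean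
over orderings ✓`sum_idx_fst`, `Ad` of a unitary isometric, `‖Ad_{TC_j} − Ad_{C_{j+1}}‖ ≤ 2η_j` termwise).
[cite: Balaban1985Averaging, (97) p.32, (82) p.30; Balaban1984PropagatorsI, (1.16)–(1.18) p.20; Balaban1985BackgroundPropagators, (3.19) p.393] -/
theorem norm_ns_sub_refMean_le_of_lt {k₀ : ℕ} (hk₀ : k₀ ≤ P.m + P.K)
    (T : (j : ℕ) → Site P (j + 1) → Idx P → (Matrix (Fin N) (Fin N) ℂ)ˣ) (hT : ∀ j, j < k₀ → ∀ y i, T j y i ∈ U1 (Matrix (Fin N) (Fin N) ℂ))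
    (ns : (j : ℕ) → Site P j → Matrix (Fin N) (Fin N) ℂ) (l : Site P 0 → Matrix (Fin N) (Fin N) ℂ) (h0 : ∀ x, ns 0 x = l x)
    (hstep : ∀ j, j < k₀ → ∀ (y : Site P (j + 1)), ns (j + 1) y = ((Fintype.card (Idx P) : ℝ)⁻¹) • ∑ i : Idx P, conjR (T j y i) (ns j (Site.blockSite y i.1)))
    (C : (j : ℕ) → Site P j → Site P 0 → (Matrix (Fin N) (Fin N) ℂ)ˣ) (hC : ∀ j, j ≤ k₀ → ∀ z x, C j z x ∈ U1 (Matrix (Fin N) (Fin N) ℂ)) (hC0 : ∀ x, C 0 x x = 1)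
    (η : ℕ → ℝ)
    (hclose : ∀ j, j < k₀ → ∀ (y : Site P (j + 1)) (i : Idx P), ∀ x ∈ iterBlock j (Site.blockSite y i.1),
      ‖((T j y i : (Matrix (Fin N) (Fin N) ℂ)ˣ) : Matrix (Fin N) (Fin N) ℂ) * (C j (Site.blockSite y i.1) x : Matrix (Fin N) (Fin N) ℂ) - (C (j + 1) y x : Matrix (Fin N) (Fin N) ℂ)‖ ≤ η j) :
    ∀ (k : ℕ), k ≤ k₀ → ∀ y : Site P k,
      ‖ns k y - ((((P.L : ℝ) ^ P.d) ^ k)⁻¹) • ∑ x ∈ iterBlock k y, conjR (C k y x) (l x)‖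
        ≤ (2 * ∑ j ∈ range k, η j) * (((((P.L : ℝ) ^ P.d) ^ k)⁻¹) * ∑ x ∈ iterBlock k y, ‖l x‖) := by
  intro k
  induction k with
  | zero =>
    intro _ y
    rw [iterBlock_zero, Finset.sum_singleton, Finset.sum_singleton, hC0, one_conjR, h0, pow_zero, inv_one, one_smul, sub_self, norm_zero,
      Finset.sum_range_zero, mul_zero, zero_mul]
  | succ j ih =>
    intro hj y
    have hjk : j < k₀ := Nat.lt_of_succ_le hj
    have hj' : j ≤ k₀ := hjk.le
    have hj1 : j + 1 ≤ P.m + P.K := hj.trans hk₀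
    have hL : (0 : ℝ) < (P.L : ℝ) ^ P.d := by have := P.L_pos; positivity
    set p : ℕ := Fintype.card (Equiv.Perm (Fin P.d)) * Fintype.card (Equiv.Perm (Fin P.d)) with hp
    have hp0 : (0 : ℝ) < (p : ℝ) := by
      have : 0 < Fintype.card (Equiv.Perm (Fin P.d)) := Fintype.card_pos
      rw [hp]; positivity
    have hcI : (Fintype.card (Idx P) : ℝ) = (P.L : ℝ) ^ P.d * p := by
      have hc : Fintype.card (Idx P) = P.L ^ P.d * p := by
        rw [hp, Fintype.card_prod, Fintype.card_prod, Fintype.card_fun, Fintype.card_fin, Fintype.card_fin]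
      rw [hc]; push_cast; ring
    set cj : ℝ := ((((P.L : ℝ) ^ P.d) ^ j)⁻¹) with hcj
    have hcj0 : 0 ≤ cj := by rw [hcj]; positivity
    set A : Site P j → Matrix (Fin N) (Fin N) ℂ := fun z => cj • ∑ x ∈ iterBlock j z, conjR (C j z x) (l x) with hA
    set M : Site P j → ℝ := fun z => cj * ∑ x ∈ iterBlock j z, ‖l x‖ with hM
    set δ : ℝ := 2 * ∑ t ∈ range j, η t with hδ
    have hIH : ∀ z : Site P j, ‖ns j z - A z‖ ≤ δ * M z := fun z => ih hj' z
    -- the scalar bookkeeping `(L^d)^{-(j+1)} = |Idx|⁻¹·|Perm|²·(L^d)^{-j}`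
    have hscal : ((((P.L : ℝ) ^ P.d) ^ (j + 1))⁻¹) = (Fintype.card (Idx P) : ℝ)⁻¹ * (p : ℝ) * cj := by
      rw [hcI, hcj, pow_succ, mul_inv, mul_inv]
      field_simp
    -- nesting of the blocks
    have eL : ∀ (G : Site P 0 → Matrix (Fin N) (Fin N) ℂ), ∑ x ∈ iterBlock (j + 1) y, G x = ∑ r : Fin P.d → Fin P.L, ∑ x ∈ iterBlock j (Site.blockSite y r), G x :=
      fun G => by rw [sum_iterBlock_succ, sum_block hj1 y]
    have eL' : ∑ x ∈ iterBlock (j + 1) y, ‖l x‖ = ∑ r : Fin P.d → Fin P.L, ∑ x ∈ iterBlock j (Site.blockSite y r), ‖l x‖ := by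
      rw [sum_iterBlock_succ, sum_block hj1 y]
    have hsplitA : ((((P.L : ℝ) ^ P.d) ^ (j + 1))⁻¹) • ∑ x ∈ iterBlock (j + 1) y, conjR (C (j + 1) y x) (l x)
        = ((Fintype.card (Idx P) : ℝ)⁻¹) • ∑ i : Idx P, cj • ∑ x ∈ iterBlock j (Site.blockSite y i.1), conjR (C (j + 1) y x) (l x) := by
      rw [eL, hscal, ← smul_smul, ← smul_smul, Finset.smul_sum,
        sum_idx_fst (fun r => cj • ∑ x ∈ iterBlock j (Site.blockSite y r), conjR (C (j + 1) y x) (l x)), ← hp, Nat.cast_smul_eq_nsmul]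
    have hsplitM : ((((P.L : ℝ) ^ P.d) ^ (j + 1))⁻¹) * ∑ x ∈ iterBlock (j + 1) y, ‖l x‖
        = ((Fintype.card (Idx P) : ℝ)⁻¹) * ∑ i : Idx P, M (Site.blockSite y i.1) := by
      rw [sum_idx_fst (fun r => M (Site.blockSite y r)), ← hp, nsmul_eq_mul, eL', hscal]
      simp only [hM]
      rw [← Finset.mul_sum]
      ring
    -- termwise bound
    have hterm : ∀ i : Idx P, ‖conjR (T j y i) (ns j (Site.blockSite y i.1)) - cj • ∑ x ∈ iterBlock j (Site.blockSite y i.1), conjR (C (j + 1) y x) (l x)‖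
        ≤ (δ + 2 * η j) * M (Site.blockSite y i.1) := by
      intro i
      set z := Site.blockSite y i.1 with hz
      have h1 : ‖conjR (T j y i) (ns j z) - conjR (T j y i) (A z)‖ ≤ δ * M z := by
        rw [← conjR_sub, norm_conjR (hT j hjk y i)]; exact hIH z
      have h2 : conjR (T j y i) (A z) = cj • ∑ x ∈ iterBlock j z, conjR (T j y i * C j z x) (l x) := by
        simp only [hA]
        rw [conjR_smul_real, conjR_sum]
        congr 1
        exact Finset.sum_congr rfl fun x _ => conjR_conjR _ _ _
      have h3 : ‖cj • ∑ x ∈ iterBlock j z, conjR (T j y i * C j z x) (l x) - cj • ∑ x ∈ iterBlock j z, conjR (C (j + 1) y x) (l x)‖ ≤ 2 * η j * M z := by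
        rw [← smul_sub, ← Finset.sum_sub_distrib, norm_smul, Real.norm_of_nonneg hcj0]
        have hsum : ‖∑ x ∈ iterBlock j z, (conjR (T j y i * C j z x) (l x) - conjR (C (j + 1) y x) (l x))‖ ≤ ∑ x ∈ iterBlock j z, 2 * η j * ‖l x‖ := by
          refine (norm_sum_le _ _).trans (Finset.sum_le_sum fun x hx => ?_)
          have hU : T j y i * C j z x ∈ U1 (Matrix (Fin N) (Fin N) ℂ) := (U1 _).mul_mem (hT j hjk y i) (hC j hj' z x)
          refine (norm_conjR_sub_conjR_le (hC (j + 1) hj y x) hU (l x)).trans ?_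
          have hTC : ‖((T j y i * C j z x : (Matrix (Fin N) (Fin N) ℂ)ˣ) : Matrix (Fin N) (Fin N) ℂ) - (C (j + 1) y x : Matrix (Fin N) (Fin N) ℂ)‖ ≤ η j := by
            rw [Units.val_mul]; exact hclose j hjk y i x (by rw [← hz]; exact hx)
          exact mul_le_mul_of_nonneg_right (mul_le_mul_of_nonneg_left hTC (by norm_num)) (norm_nonneg _)
        calc cj * ‖∑ x ∈ iterBlock j z, (conjR (T j y i * C j z x) (l x) - conjR (C (j + 1) y x) (l x))‖
            ≤ cj * ∑ x ∈ iterBlock j z, 2 * η j * ‖l x‖ := mul_le_mul_of_nonneg_left hsum hcj0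
          _ = 2 * η j * M z := by simp only [hM]; rw [← Finset.mul_sum]; ring
      calc ‖conjR (T j y i) (ns j z) - cj • ∑ x ∈ iterBlock j z, conjR (C (j + 1) y x) (l x)‖
          ≤ ‖conjR (T j y i) (ns j z) - conjR (T j y i) (A z)‖ + ‖conjR (T j y i) (A z) - cj • ∑ x ∈ iterBlock j z, conjR (C (j + 1) y x) (l x)‖ :=
            norm_sub_le_norm_sub_add_norm_sub _ _ _
        _ ≤ δ * M z + 2 * η j * M z := by
            have h3' : ‖conjR (T j y i) (A z) - cj • ∑ x ∈ iterBlock j z, conjR (C (j + 1) y x) (l x)‖ ≤ 2 * η j * M z := by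
              rw [h2]; exact h3
            exact add_le_add h1 h3'
        _ = (δ + 2 * η j) * M z := by ring
    have hδ' : 2 * ∑ t ∈ range (j + 1), η t = δ + 2 * η j := by rw [Finset.sum_range_succ, hδ]; ring
    have hcI0 : 0 ≤ (Fintype.card (Idx P) : ℝ)⁻¹ := by positivity
    have hfin : ‖((Fintype.card (Idx P) : ℝ)⁻¹) • ∑ i : Idx P,
        (conjR (T j y i) (ns j (Site.blockSite y i.1)) - cj • ∑ x ∈ iterBlock j (Site.blockSite y i.1), conjR (C (j + 1) y x) (l x))‖
          ≤ (Fintype.card (Idx P) : ℝ)⁻¹ * ∑ i : Idx P, (δ + 2 * η j) * M (Site.blockSite y i.1) := by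
      rw [norm_smul, norm_inv, Real.norm_natCast]
      exact mul_le_mul_of_nonneg_left ((norm_sum_le _ _).trans (Finset.sum_le_sum fun i _ => hterm i)) hcI0
    rw [hstep j hjk y, hsplitA, hsplitM, hδ', ← smul_sub, ← Finset.sum_sub_distrib]
    refine hfin.trans (le_of_eq ?_)
    rw [← Finset.mul_sum]
    ring

end Guarded

/-! ## §3 From `ns_{k₀} = 0` to the smallness of the top-level comb sums -/

section Comb

variable {P : Params}

/-- ★★ **`ns_{k₀} = 0` MAKES EVERY TOP-LEVEL COMB SUM SMALL**: with the data of §2 and a top-level comb family `W_{y,r}` (unitary) such that `‖C_{k₀,y,x_{y,r}} − g_y·W_{y,r}‖ ≤ η′`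
(`g_y` unitary, `x_{y,r} = fibreSite 0 k₀ y r`), the vanishing of `ns_{k₀}` gives on every top block `‖Σ_r Ad_{W_{y,r}} l(x_{y,r})‖ ≤ (2Σ_{j<k₀}η_j + 2η′)·Σ_r‖l(x_{y,r})‖`
(§2 at `k₀`, divide by `(L^d)^{−k₀}`, re-index the block by offsets ✓`sum_iterBlock_eq`, swap `C` for `g·W` at cost `2η′` termwise, `Ad_g` isometric).
[cite: Balaban1985Averaging, (97) p.32, pp.24–25; Balaban1984PropagatorsI, (1.18) p.20] -/
theorem norm_combSum_le_of_ns_eq_zero {k₀ : ℕ} (hk₀ : k₀ ≤ P.m + P.K)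
    (T : (j : ℕ) → Site P (j + 1) → Idx P → (Matrix (Fin N) (Fin N) ℂ)ˣ) (hT : ∀ j, j < k₀ → ∀ y i, T j y i ∈ U1 (Matrix (Fin N) (Fin N) ℂ))
    (ns : (j : ℕ) → Site P j → Matrix (Fin N) (Fin N) ℂ) (l : Site P 0 → Matrix (Fin N) (Fin N) ℂ) (h0 : ∀ x, ns 0 x = l x)
    (hstep : ∀ j, j < k₀ → ∀ (y : Site P (j + 1)), ns (j + 1) y = ((Fintype.card (Idx P) : ℝ)⁻¹) • ∑ i : Idx P, conjR (T j y i) (ns j (Site.blockSite y i.1)))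
    (C : (j : ℕ) → Site P j → Site P 0 → (Matrix (Fin N) (Fin N) ℂ)ˣ) (hC : ∀ j, j ≤ k₀ → ∀ z x, C j z x ∈ U1 (Matrix (Fin N) (Fin N) ℂ)) (hC0 : ∀ x, C 0 x x = 1)
    (η : ℕ → ℝ)
    (hclose : ∀ j, j < k₀ → ∀ (y : Site P (j + 1)) (i : Idx P), ∀ x ∈ iterBlock j (Site.blockSite y i.1),
      ‖((T j y i : (Matrix (Fin N) (Fin N) ℂ)ˣ) : Matrix (Fin N) (Fin N) ℂ) * (C j (Site.blockSite y i.1) x : Matrix (Fin N) (Fin N) ℂ) - (C (j + 1) y x : Matrix (Fin N) (Fin N) ℂ)‖ ≤ η j)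
    (W : Site P k₀ → (Fin P.d → Fin (P.L ^ k₀)) → (Matrix (Fin N) (Fin N) ℂ)ˣ) (hW : ∀ y r, W y r ∈ U1 (Matrix (Fin N) (Fin N) ℂ))
    (g : Site P k₀ → (Matrix (Fin N) (Fin N) ℂ)ˣ) (hg : ∀ y, g y ∈ U1 (Matrix (Fin N) (Fin N) ℂ)) {η' : ℝ}
    (htop : ∀ (y : Site P k₀) (r : Fin P.d → Fin (P.L ^ k₀)),
      ‖(C k₀ y (Site.fibreSite 0 k₀ y r) : Matrix (Fin N) (Fin N) ℂ) - (g y : Matrix (Fin N) (Fin N) ℂ) * (W y r : Matrix (Fin N) (Fin N) ℂ)‖ ≤ η')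
    (hker : ∀ y, ns k₀ y = 0) (y : Site P k₀) :
    ‖∑ r : Fin P.d → Fin (P.L ^ k₀), conjR (W y r) (l (Site.fibreSite 0 k₀ y r))‖
      ≤ (2 * ∑ j ∈ range k₀, η j + 2 * η') * ∑ r : Fin P.d → Fin (P.L ^ k₀), ‖l (Site.fibreSite 0 k₀ y r)‖ := by
  have hmain := norm_ns_sub_refMean_le_of_lt hk₀ T hT ns l h0 hstep C hC hC0 η hclose k₀ le_rfl y
  set c : ℝ := ((((P.L : ℝ) ^ P.d) ^ k₀)⁻¹) with hc
  have hc0 : 0 < c := by rw [hc]; have := P.L_pos; positivity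
  set δ : ℝ := 2 * ∑ j ∈ range k₀, η j with hδ
  -- re-index the top block by offsets (`blockSiteK k₀ y r` is `fibreSite 0 k₀ y r` by definition)
  have eS : ∑ x ∈ iterBlock k₀ y, conjR (C k₀ y x) (l x) = ∑ r : Fin P.d → Fin (P.L ^ k₀), conjR (C k₀ y (Site.fibreSite 0 k₀ y r)) (l (Site.fibreSite 0 k₀ y r)) :=
    B5Eq117TorusCarriers.sum_iterBlock_eq hk₀ y _
  have eM : ∑ x ∈ iterBlock k₀ y, ‖l x‖ = ∑ r : Fin P.d → Fin (P.L ^ k₀), ‖l (Site.fibreSite 0 k₀ y r)‖ :=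
    B5Eq117TorusCarriers.sum_iterBlock_eq hk₀ y _
  set S : Matrix (Fin N) (Fin N) ℂ := ∑ r : Fin P.d → Fin (P.L ^ k₀), conjR (C k₀ y (Site.fibreSite 0 k₀ y r)) (l (Site.fibreSite 0 k₀ y r)) with hS
  set Ml : ℝ := ∑ r : Fin P.d → Fin (P.L ^ k₀), ‖l (Site.fibreSite 0 k₀ y r)‖ with hMl
  have hMl0 : 0 ≤ Ml := Finset.sum_nonneg fun _ _ => norm_nonneg _
  -- `‖S‖ ≤ δ·Ml`
  rw [hker y, eS, eM, zero_sub, norm_neg, norm_smul, Real.norm_of_nonneg hc0.le] at hmain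
  have hS1 : ‖S‖ ≤ δ * Ml := by
    have h1 : c * ‖S‖ ≤ c * (δ * Ml) := by rw [hS, hMl]; linarith [hmain]
    exact le_of_mul_le_mul_left h1 hc0
  -- swap `C_{k₀,y,x_r}` for `g_y·W_{y,r}`
  have hS2 : ‖∑ r : Fin P.d → Fin (P.L ^ k₀), conjR (g y * W y r) (l (Site.fibreSite 0 k₀ y r)) - S‖ ≤ 2 * η' * Ml := by
    rw [hS, ← Finset.sum_sub_distrib]
    refine (norm_sum_le _ _).trans ?_
    rw [hMl, Finset.mul_sum]
    refine Finset.sum_le_sum fun r _ => ?_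
    refine (norm_conjR_sub_conjR_le (hC k₀ le_rfl y _) ((U1 _).mul_mem (hg y) (hW y r)) _).trans ?_
    rw [Units.val_mul, norm_sub_rev]
    exact mul_le_mul_of_nonneg_right (mul_le_mul_of_nonneg_left (htop y r) (by norm_num)) (norm_nonneg _)
  -- `Ad_g` is an isometry
  have hiso : ‖∑ r : Fin P.d → Fin (P.L ^ k₀), conjR (W y r) (l (Site.fibreSite 0 k₀ y r))‖ = ‖∑ r : Fin P.d → Fin (P.L ^ k₀), conjR (g y * W y r) (l (Site.fibreSite 0 k₀ y r))‖ := by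
    rw [← norm_conjR (hg y), conjR_sum]
    congr 1
    exact Finset.sum_congr rfl fun r _ => conjR_conjR _ _ _
  rw [hiso]
  calc ‖∑ r : Fin P.d → Fin (P.L ^ k₀), conjR (g y * W y r) (l (Site.fibreSite 0 k₀ y r))‖
      ≤ ‖∑ r : Fin P.d → Fin (P.L ^ k₀), conjR (g y * W y r) (l (Site.fibreSite 0 k₀ y r)) - S‖ + ‖S‖ := norm_le_norm_sub_add _ _
    _ ≤ 2 * η' * Ml + δ * Ml := add_le_add hS2 hS1
    _ = (δ + 2 * η') * Ml := by ring

end Comb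

/-! ## §4 At the T³ member: `ns_{K−n} l = 0` ⟹ `‖toL2S l‖² ≤ 2‖D^η(toL2S l)‖²`, closeness data displayed -/

section T3

open Literature.MathematicalPhysics.QuantumFieldTheory.Balaban1983to89.T3ContinuumYM3Torus
open T3RegularMinimiser (regThreshold)
open T3PrintedRegularMinimiser (RegPr)
open T3SectALandauChart (bgUnits)
open Summit.QuantumFields.YangMills.Theorems.Prop7SectET3HilbertLetters (toL2S DL2)
open Summit.QuantumFields.YangMills.Theorems.Prop7SymAvgTwSym (holT_mem_U1 unitsField_toUField_mem_U1' emlIterU_bgUnits_mem_U1_of_regPr)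

variable (F : T3Family) {n K : ℕ}

/-- ★★★ **ROW-B ∘ (Q1): AT A PRINTED-REGULAR BACKGROUND, `ns_{K−n} l = 0` ⟹ `‖toL2S l‖² ≤ 2·‖D^η_{U₀}(toL2S l)‖²`, WITH THE TOWER-CLOSENESS DATA DISPLAYED.**  `U₀ ∈ 𝔘_k(ε₀)`
(`RegPr F n K ε₀ U₀`, `10⁷L³ε₀ ≤ 1`); `ns` the averaging sequence of the gauge parameter `l` against the background tower `Ū₀♭⁽ʲ⁾ = emlIterU j (bgUnits F K U₀)` — the `h0`∕`hsucc` of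
✓`Prop7SymAvgTwSGaugeDir.QTwS_gaugeDir_of_avgSeq` VERBATIM; DISPLAYED: unitary references `C_{j,z,x}` (`j ≤ K − n`, `C_{0,x,x} = 1`) with per-level closeness `η_j ≥ 0` to the
stair transports (`‖Ū₀♭⁽ʲ⁾(Γ_{y,i})·C_{j,blockSite y i.1,x} − C_{j+1,y,x}‖ ≤ η_j` on the sub-blocks, `j < K − n`) and a top comparison `‖C_{K−n,y,x_r} − g_y·U₀♭(Γ_{ȳ,x_r})‖ ≤ η′`
against the fine corner combs (`g_y` unitary), in the window `108ε₀² + 4(2Σ_{j<K−n}η_j + 2η′)² ≤ 1`.  THEN `ns (K − n) = 0` implies the Poincaré inequality of ✓`normSq_toL2S_le_two_mul_of_combMean_small`.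
Composition: §1 (bridge) → §3 (comb sums small, `δ = 2Ση_j + 2η′`) → ✓p656969 (`hU` from `RegPr.plaqSmall`, `regThreshold = ε₀L^{−2(K−n)}`).
[cite: Balaban1985BackgroundPropagators, Thm 3.11 p.416, (3.19) p.393, (3.21) p.394; Balaban1985Averaging, (97) p.32, pp.24–25; Balaban1985Variational, (2) p.278] -/
theorem normSq_toL2S_le_two_mul_of_ns_eq_zero {c₀ : ℝ} [Fact (0 < c₀)] {ε₀ : ℝ} (hε₀ : 0 < ε₀) (hε7 : 10 ^ 7 * (F.L : ℝ) ^ 3 * ε₀ ≤ 1)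
    (U₀ : GaugeField (F.P K) 0 (Matrix.specialUnitaryGroup (Fin 2) ℂ)) (hreg : RegPr F n K ε₀ U₀)
    (ns : (j : ℕ) → Site (F.P K) j → Matrix (Fin 2) (Fin 2) ℂ) (l : Site (F.P K) 0 → Matrix (Fin 2) (Fin 2) ℂ) (h0 : ns 0 = l)
    (hsucc : ∀ (j : ℕ) (y : Site (F.P K) (j + 1)), ns (j + 1) y = ns j (emb y) - meanCLM (Idx (F.P K)) (Matrix (Fin 2) (Fin 2) ℂ) fun i : Idx (F.P K) =>
        ns j (emb y) - ((holT (emlIterU j (bgUnits F K U₀)) (emb y) (stairWord i.2.1 (off i.1)) : (Matrix (Fin 2) (Fin 2) ℂ)ˣ) : Matrix (Fin 2) (Fin 2) ℂ) *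
          ns j (transl (emb y) (disp (stairWord i.2.1 (off i.1)))) * (((holT (emlIterU j (bgUnits F K U₀)) (emb y) (stairWord i.2.1 (off i.1)))⁻¹ : (Matrix (Fin 2) (Fin 2) ℂ)ˣ) : Matrix (Fin 2) (Fin 2) ℂ))
    (C : (j : ℕ) → Site (F.P K) j → Site (F.P K) 0 → (Matrix (Fin 2) (Fin 2) ℂ)ˣ) (hC : ∀ j, j ≤ K - n → ∀ z x, C j z x ∈ U1 (Matrix (Fin 2) (Fin 2) ℂ))
    (hC0 : ∀ x, C 0 x x = 1) (η : ℕ → ℝ) (hη : ∀ j, 0 ≤ η j)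
    (hclose : ∀ j, j < K - n → ∀ (y : Site (F.P K) (j + 1)) (i : Idx (F.P K)), ∀ x ∈ iterBlock j (Site.blockSite y i.1),
      ‖((holT (emlIterU j (bgUnits F K U₀)) (emb y) (stairWord i.2.1 (off i.1)) : (Matrix (Fin 2) (Fin 2) ℂ)ˣ) : Matrix (Fin 2) (Fin 2) ℂ) *
          (C j (Site.blockSite y i.1) x : Matrix (Fin 2) (Fin 2) ℂ) - (C (j + 1) y x : Matrix (Fin 2) (Fin 2) ℂ)‖ ≤ η j)
    (g : Site (F.P K) (K - n) → (Matrix (Fin 2) (Fin 2) ℂ)ˣ) (hg : ∀ y, g y ∈ U1 (Matrix (Fin 2) (Fin 2) ℂ)) {η' : ℝ} (hη' : 0 ≤ η')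
    (htop : ∀ (y : Site (F.P K) (K - n)) (r : Fin (F.P K).d → Fin ((F.P K).L ^ (K - n))),
      ‖(C (K - n) y (Site.fibreSite 0 (K - n) y r) : Matrix (Fin 2) (Fin 2) ℂ) -
          (g y : Matrix (Fin 2) (Fin 2) ℂ) * ((holT (unitsField (toUField U₀)) (Site.fibreSite 0 (K - n) y fun _ => ⟨0, pow_pos (F.P K).L_pos (K - n)⟩)
            (treeWord fun ν => ((r ν : ℕ) : ℤ)) : (Matrix (Fin 2) (Fin 2) ℂ)ˣ) : Matrix (Fin 2) (Fin 2) ℂ)‖ ≤ η')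
    (hwin : 108 * ε₀ ^ 2 + 4 * (2 * ∑ j ∈ range (K - n), η j + 2 * η') ^ 2 ≤ 1)
    (hker : ∀ y, ns (K - n) y = 0) :
    ‖toL2S F K c₀ l‖ ^ 2 ≤ 2 * ‖DL2 F n K c₀ U₀ (toL2S F K c₀ l)‖ ^ 2 := by
  have hk₀ : K - n ≤ (F.P K).m + (F.P K).K := by
    show K - n ≤ F.m + K; have := F.hm; omega
  have hL0 : (0 : ℝ) < (F.L : ℝ) := by have := F.hL.2; exact_mod_cast (show 0 < F.L by omega)
  -- the plaquette row of ✓p656969 from `RegPr`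
  have hU : ∀ p : Plaq (F.P K) 0, dist1 (GaugeField.plaqHol U₀ p) ≤ ε₀ * (((F.L : ℝ) ^ (K - n)) ^ 2)⁻¹ := by
    intro p
    have h := hreg.plaqSmall p
    have e : regThreshold F n K ε₀ = ε₀ * (((F.L : ℝ) ^ (K - n)) ^ 2)⁻¹ := by
      unfold regThreshold; rw [inv_pow, ← pow_mul, mul_comm 2 (K - n), pow_mul]
    rw [e] at h
    exact h.le
  -- the transports: unitary below the top level
  set T : (j : ℕ) → Site (F.P K) (j + 1) → Idx (F.P K) → (Matrix (Fin 2) (Fin 2) ℂ)ˣ :=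
    fun j y i => holT (emlIterU j (bgUnits F K U₀)) (emb y) (stairWord i.2.1 (off i.1)) with hTdef
  have hT : ∀ j, j < K - n → ∀ (y : Site (F.P K) (j + 1)) (i : Idx (F.P K)), T j y i ∈ U1 (Matrix (Fin 2) (Fin 2) ℂ) :=
    fun j hj y i => holT_mem_U1 (fun b => emlIterU_bgUnits_mem_U1_of_regPr F hε₀ hε7 hreg hj.le b) _ _
  have hstep : ∀ j, j < K - n → ∀ (y : Site (F.P K) (j + 1)),
      ns (j + 1) y = ((Fintype.card (Idx (F.P K)) : ℝ)⁻¹) • ∑ i : Idx (F.P K), conjR (T j y i) (ns j (Site.blockSite y i.1)) :=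
    fun j _ y => hstep_of_hsucc T ns hsucc j y
  -- the fine corner combs are unitary
  set W : Site (F.P K) (K - n) → (Fin (F.P K).d → Fin ((F.P K).L ^ (K - n))) → (Matrix (Fin 2) (Fin 2) ℂ)ˣ :=
    fun y r => holT (unitsField (toUField U₀)) (Site.fibreSite 0 (K - n) y fun _ => ⟨0, pow_pos (F.P K).L_pos (K - n)⟩) (treeWord fun ν => ((r ν : ℕ) : ℤ)) with hWdef
  have hW : ∀ y r, W y r ∈ U1 (Matrix (Fin 2) (Fin 2) ℂ) := fun y r => holT_mem_U1 (fun b => unitsField_toUField_mem_U1' U₀ b) _ _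
  have hδ0 : 0 ≤ 2 * ∑ j ∈ range (K - n), η j + 2 * η' := by
    have : 0 ≤ ∑ j ∈ range (K - n), η j := Finset.sum_nonneg fun j _ => hη j
    positivity
  have hcomb := fun y => norm_combSum_le_of_ns_eq_zero hk₀ T hT ns l (fun x => by rw [h0]) hstep C hC hC0 η hclose W hW g hg htop hker y
  exact normSq_toL2S_le_two_mul_of_combMean_small F U₀ hε₀.le hδ0 hwin hU l hcomb

end T3

/-! ## §5 The socket in the currency of the R2b″ rows assembler (`hPoinc` on the sector `Z` = «the nested mean of `l₁` vanishes at level `K − n`») -/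

section Currency

open Literature.MathematicalPhysics.QuantumFieldTheory.Balaban1983to89.T3ContinuumYM3Torus
open T3PrintedRegularMinimiser (RegPr)
open T3SectALandauChart (bgUnits)
open Summit.QuantumFields.YangMills.Theorems.Prop7SectET3HilbertLetters (toL2S DL2)
open Summit.QuantumFields.YangMills.Theorems.Prop7SectET3GaugeProjector (NS)

variable (F : T3Family) {n K : ℕ} (h : n ≤ K)

/-- ★★★ **ROW-B IN THE ASSEMBLER'S CURRENCY — `hPoinc` WITH `P₂ = 2` ON THE SECTOR `Z`**: at `U₀ ∈ 𝔘_k(ε₀)` (`RegPr`, `10⁷L³ε₀ ≤ 1`) and under the displayed tower-closeness rows of §4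
(`C`, `η`, `g`, `η′`, window `108ε₀² + 4(2Ση_j + 2η′)² ≤ 1`): for every gauge parameter `l₁` with `toL2S l₁ ∈ N_S(U₀)` (not used) and `Z l₁` — «there is an averaging sequence `ns`
of `l₁` against the background tower (`ns 0 = l₁`, the `hsucc` recursion of ✓`QTwS_gaugeDir_of_avgSeq`) with `ns (K − n) = 0`» — one has `‖toL2S l₁‖² ≤ 2·‖D^η_{U₀}(toL2S l₁)‖²`.
This is the `hPoinc` row of ★w5-20520 g7's `hP_of_poincareZ`∕`hS_of_rowsZ` at `P₂ := 2`, `Z := fun l₁ => ∃ ns, …` (by §4).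
[cite: Balaban1985BackgroundPropagators, Thm 3.11 p.416, (3.19) p.393, (3.21) p.394; Balaban1985Averaging, (97) p.32] -/
theorem hPoinc_of_towerCloseness {c₀ : ℝ} [Fact (0 < c₀)] (cB : ℝ) {ε₀ : ℝ} (hε₀ : 0 < ε₀) (hε7 : 10 ^ 7 * (F.L : ℝ) ^ 3 * ε₀ ≤ 1)
    (U₀ : GaugeField (F.P K) 0 (Matrix.specialUnitaryGroup (Fin 2) ℂ)) (hreg : RegPr F n K ε₀ U₀)
    (C : (j : ℕ) → Site (F.P K) j → Site (F.P K) 0 → (Matrix (Fin 2) (Fin 2) ℂ)ˣ) (hC : ∀ j, j ≤ K - n → ∀ z x, C j z x ∈ U1 (Matrix (Fin 2) (Fin 2) ℂ))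
    (hC0 : ∀ x, C 0 x x = 1) (η : ℕ → ℝ) (hη : ∀ j, 0 ≤ η j)
    (hclose : ∀ j, j < K - n → ∀ (y : Site (F.P K) (j + 1)) (i : Idx (F.P K)), ∀ x ∈ iterBlock j (Site.blockSite y i.1),
      ‖((holT (emlIterU j (bgUnits F K U₀)) (emb y) (stairWord i.2.1 (off i.1)) : (Matrix (Fin 2) (Fin 2) ℂ)ˣ) : Matrix (Fin 2) (Fin 2) ℂ) *
          (C j (Site.blockSite y i.1) x : Matrix (Fin 2) (Fin 2) ℂ) - (C (j + 1) y x : Matrix (Fin 2) (Fin 2) ℂ)‖ ≤ η j)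
    (g : Site (F.P K) (K - n) → (Matrix (Fin 2) (Fin 2) ℂ)ˣ) (hg : ∀ y, g y ∈ U1 (Matrix (Fin 2) (Fin 2) ℂ)) {η' : ℝ} (hη' : 0 ≤ η')
    (htop : ∀ (y : Site (F.P K) (K - n)) (r : Fin (F.P K).d → Fin ((F.P K).L ^ (K - n))),
      ‖(C (K - n) y (Site.fibreSite 0 (K - n) y r) : Matrix (Fin 2) (Fin 2) ℂ) -
          (g y : Matrix (Fin 2) (Fin 2) ℂ) * ((holT (unitsField (toUField U₀)) (Site.fibreSite 0 (K - n) y fun _ => ⟨0, pow_pos (F.P K).L_pos (K - n)⟩)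
            (treeWord fun ν => ((r ν : ℕ) : ℤ)) : (Matrix (Fin 2) (Fin 2) ℂ)ˣ) : Matrix (Fin 2) (Fin 2) ℂ)‖ ≤ η')
    (hwin : 108 * ε₀ ^ 2 + 4 * (2 * ∑ j ∈ range (K - n), η j + 2 * η') ^ 2 ≤ 1) :
    ∀ l₁ : Site (F.P K) 0 → Matrix (Fin 2) (Fin 2) ℂ, toL2S F K c₀ l₁ ∈ NS F n K h c₀ cB U₀ →
      (∃ ns : (j : ℕ) → Site (F.P K) j → Matrix (Fin 2) (Fin 2) ℂ, ns 0 = l₁ ∧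
        (∀ (j : ℕ) (y : Site (F.P K) (j + 1)), ns (j + 1) y = ns j (emb y) - meanCLM (Idx (F.P K)) (Matrix (Fin 2) (Fin 2) ℂ) fun i : Idx (F.P K) =>
          ns j (emb y) - ((holT (emlIterU j (bgUnits F K U₀)) (emb y) (stairWord i.2.1 (off i.1)) : (Matrix (Fin 2) (Fin 2) ℂ)ˣ) : Matrix (Fin 2) (Fin 2) ℂ) *
            ns j (transl (emb y) (disp (stairWord i.2.1 (off i.1)))) * (((holT (emlIterU j (bgUnits F K U₀)) (emb y) (stairWord i.2.1 (off i.1)))⁻¹ : (Matrix (Fin 2) (Fin 2) ℂ)ˣ) : Matrix (Fin 2) (Fin 2) ℂ)) ∧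
        ∀ y, ns (K - n) y = 0) →
      ‖toL2S F K c₀ l₁‖ ^ 2 ≤ 2 * ‖DL2 F n K c₀ U₀ (toL2S F K c₀ l₁)‖ ^ 2 := by
  intro l₁ _ hZ
  obtain ⟨ns, h0, hsucc, hker⟩ := hZ
  exact normSq_toL2S_le_two_mul_of_ns_eq_zero F hε₀ hε7 U₀ hreg ns l₁ h0 hsucc C hC hC0 η hη hclose g hg hη' htop hwin hker

end Currency

end Summit.QuantumFields.YangMills.Theorems.Prop7NestedMeanPoincare

end
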